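/-
Copyright: statement-level skeleton of a published paper (lit-balaban cell, Phase-2 proof seat p10, gen 5). No proof claims
beyond what the kernel checks below.
-/
import Mathlib
import Literature.MathematicalPhysics.QuantumFieldTheory.BalabanImbrieJaffe1984to88.BIJ85FibreDuality

/-!
# `BalabanImbrieJaffe1984to88.BIJ85FibreCurlIntertwine` — T. Bałaban, J. Imbrie, A. Jaffe, *Renormalization of the Higgs model:
minimizers, propagators and the stability of mean field theory*, Commun. Math. Phys. **97** (1985) 299–329
[BalabanImbrieJaffe1985]: Sect. 7.1 pp. 322–325 — **the intertwining `Q^{e*}_k∂^{(1)} = ∂Q^{s*}_k` (7.1.18) FIBREWISE, for every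
block size n = L^k, and the τ₂ pairing on curls**: at every offset l = 2πk (k : Fin d → Fin n) the (7.1.11) weight turns a unit
curl `∂^{(1)}B` into an η-curl, `w̄_{μν}(p′+l)(∂^{(1)}B)_{μν} = (∂(p′+l) ∧ β_l)_{μν}`, `β_l(ν) = conj(ω_ν^{n−1}Π_{ρ≠ν}v_ρ)(p′+l)B_ν`, and
the multiplier one-form of `BIJ85FibreDuality` evaluates on curls to `A_ν(∂^{(1)}B) = (Σ_l|u(p′+l)|²)B_ν − ∂^{(1)}_ν(p′)·C` with
`Σ_l |u(p′+l)|² = 1` — the fibrewise content of *"⟨∂B, τ₂∂B⟩ = ⟨∂B, σ_k∂B⟩ = ⟨B, Δ_kB⟩ (7.1.31)"* p. 325 in the dual formulation —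
file 2 of seat p10 gen 5's all-n chain (`BIJ85FibreDuality`/`BIJ85FibreDualBound` → this → `BIJ85FibreOffCentre` → `BIJ85Thm711AllL`)

statement-level skeleton of published theorems with citation tags; proofs where landed; nothing here is a claim about
the Yang–Mills mass gap

PDF held: `paper:balaban1985-cmp97-bij-higgs-minimizers` (journal page = PDF page + 298).  Renders read as images: PDF pp.
24–27 (journal 322–325), `run/shared/lean/pub/pub-balaban/t4/b2b-balaban-t4-lit2/renders/bij1985/…-p024…p027-x2.png`.

CITATION HEADER (lean-in-tree rule).  Part of the lit-balaban TYPED SKELETON (HOME `run/shared/lean/pub/lit-balaban/`); WHAT IS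
REPRODUCED: the mechanisms of SKELETON rows **C1.Eq7.1.13-7.1.19** ((7.1.18)) and **C1.Eq7.1.28-7.1.31** ((7.1.31)) in the service
of **C1.Thm7.1.1** for all n (`HOME/lit-balaban-r15/ROWS-C1.md`, fold owner r15, referee ref-5).  THE PRINTED TEXT (p. 323
[PDF 25]): *"Furthermore Q^{e*}_k∂ = ∂Q^{s*}_k, so τ₁∂ = Q^e_k(I − P_∂)∂Q^{s*}_k = 0. (7.1.18)"*; (p. 325 [PDF 27]): *"But since τ₁∂ = 0,
⟨∂B, τ₂∂B⟩ = ⟨∂B, σ_k∂B⟩ = ⟨B, Δ_kB⟩, (7.1.31) … An explicit formula for Δ_k shows that ⟨∂B, σ_k∂B⟩ = ½(Σ_ρ|∂^{(1)}_ρ|²/φ_ρ)^{−1}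
Σ_{μ,ν}|(∂B)_{μν}|²/(φ_μφ_ν)"*; and (2.24) p. 305 *"Q^e_kQ^{e*}_k = L^{2k}I = η^{−2}I"* whose momentum form is `Σ_l|u(p′+l)|² = 1` ([6I],
in the tree as pub-balaban's `B5Prop11Leaves.sum_Ur_eq_one`).  Inputs (read-only): p27's `BIJ85Eq7111EdgeAverage` (`edgeW_eq`:
`w_{μν} = ω_μ^{n−1}ω_ν^{n−1}Π_{ρ∉{μ,ν}}v_ρ`, `om_pow_mul_conj_vSym`: `ω^{n−1}v̄ = v`), pub-balaban's `B5Prop11Fiber`/`B5Prop11Leaves`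
(`d1Sym_eq_vSym_mul`: ∂^{(1)}_μ = v_μ∂_μ at every offset, `norm_uSym_sq`, `sum_Ur_eq_one`), and `BIJ85FibreDuality` (notation).
WHAT IS KERNEL-CHECKED (zero `sorry`, standard axioms), every n ≥ 1 and every unit momentum p′ = sOf q:
 §1 `uTil` (ũ_ν = ω_ν^{n−1}Π_{ρ≠ν}v_ρ, division-free "u/v_ν with the (7.1.11) phase"), `curl1` (the unit curl ∂^{(1)}B as a plaquette
    function, (7.1.19)), `betaK`; **`conj_edgeW_mul_d1Sym`**: `w̄_{μν}·∂^{(1)}_μ = ∂_μ·conj(ũ_ν)` at EVERY offset (no genericity);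
    **`srcK_curl1`**: the source of a unit curl is an η-curl at every offset — (7.1.18) fibrewise; `divK_curl1`; `rK_mul_conj_uTil`
    (`u v_ν·conj(ũ_ν) = |u|²`);
 §2 linearity of the source / divergence / multiplier one-form in φ (`srcK_add`, `divK_add`, `AK_add`);
 §3 **`AK_curl1`**: `A_ν(∂^{(1)}B) = (Σ_l|u(p′+l)|²)·B_ν − ∂^{(1)}_ν(p′)·C` (no Δ(p′+l) = 0); `sum_norm_uSym_sq` (Σ_l|u(p′+l)|² = 1);
    **`pairing_curl1`**: for a multiplier Λ with Σ_ν∂^{(1)}_ν(p′)Λ_ν = 0, `Σ_ν Λ_νA_ν(∂^{(1)}B) = Σ_ν Λ_νB_ν`.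
NOT CLAIMED here: the analytic bounds and the assembly (files 3–4).  Unit `lit-balaban-p10` (gen 5), HOME as above.
-/

namespace Literature.MathematicalPhysics.QuantumFieldTheory.BalabanImbrieJaffe1984to88.BIJ85FibreCurlIntertwine

open scoped BigOperators ComplexConjugate
open Complex Finset
open Literature.MathematicalPhysics.QuantumFieldTheory.Balaban1983to89
open Literature.MathematicalPhysics.QuantumFieldTheory.Balaban1983to89.B5Prop11Plancherel
open Literature.MathematicalPhysics.QuantumFieldTheory.Balaban1983to89.B5Prop11Fiber
open Literature.MathematicalPhysics.QuantumFieldTheory.Balaban1983to89.B5Prop11Leaves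
open Literature.MathematicalPhysics.QuantumFieldTheory.Balaban1983to89.B5Block118
open Literature.MathematicalPhysics.QuantumFieldTheory.BalabanImbrieJaffe1984to88.BIJ85Eq7111EdgeAverage
open Literature.MathematicalPhysics.QuantumFieldTheory.BalabanImbrieJaffe1984to88.BIJ85Eq7112FibreEnergy
open Literature.MathematicalPhysics.QuantumFieldTheory.BalabanImbrieJaffe1984to88.BIJ85FibreDuality

noncomputable section

variable {d : ℕ} (n : ℕ) [NeZero n] (M : Fin d → ℕ)

/-! ## §1 The weight of (7.1.11) turns unit curls into η-curls at every offset -/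

/-- ũ_ν(p′+l) = ω_ν^{n−1}(p′+l)·Π_{ρ≠ν}v_ρ(p′+l): the division-free form of "u/v_ν with the base-point phase of w" (for v_ν ≠ 0 it
is ω_ν^{n−1}u/v_ν). [cite: BalabanImbrieJaffe1985, (7.1.11) p.322] -/
def uTil (q : Tor M) (k : Fin d → Fin n) (ν : Fin d) : ℂ :=
  om n k (sOf M q) ν ^ (n - 1) * ∏ ρ ∈ Finset.univ.erase ν, vSym n k (sOf M q) ρ

/-- The unit-lattice curl ∂^{(1)}B at the unit momentum p′, as a plaquette function (ordered orientation pairs):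
(∂^{(1)}B)_{μν} = ∂^{(1)}_μ(p′)B_ν − ∂^{(1)}_ν(p′)B_μ — the curls ∂ℋ(p) of (7.1.19a). [cite: BalabanImbrieJaffe1985, (7.1.19a) p.323] -/
def curl1 (q : Tor M) (B : Fin d → ℂ) : Fin d × Fin d → ℂ :=
  fun a => d1Sym (sOf M q) a.1 * B a.2 - d1Sym (sOf M q) a.2 * B a.1

/-- The η-lattice one-form β_l = conj(ũ(p′+l))⊙B attached to a unit one-form B at the offset l (the momentum components of
Q^{s*}_kB, cf. (7.1.18)). [cite: BalabanImbrieJaffe1985, (7.1.18) p.323] -/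
def betaK (q : Tor M) (B : Fin d → ℂ) (k : Fin d → Fin n) (ν : Fin d) : ℂ := conj (uTil n M q k ν) * B ν

/-- kernel: conj(ω_ρ^{n−1})·v_ρ = v̄_ρ at every offset (conjugate of p27's `om_pow_mul_conj_vSym`).
[cite: BalabanImbrieJaffe1985, (7.1.11) p.322] -/
theorem conj_om_pow_mul_vSym (q : Tor M) (k : Fin d → Fin n) (ρ : Fin d) :
    conj (om n k (sOf M q) ρ ^ (n - 1)) * vSym n k (sOf M q) ρ = conj (vSym n k (sOf M q) ρ) := by
  have h := congrArg conj (om_pow_mul_conj_vSym n M k q ρ)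
  rw [map_mul, Complex.conj_conj] at h
  exact h

/-- **`w̄_{μν}(p′+l)·∂^{(1)}_μ(p′) = ∂_μ(p′+l)·conj(ũ_ν(p′+l))`** for μ ≠ ν, at EVERY offset l and every p′ (no genericity: where
∂_μ(p′+l) = 0 also ∂^{(1)}_μ(p′) = 0) — the symbol identity behind Q^{e*}_k∂^{(1)} = ∂Q^{s*}_k (7.1.18), from `edgeW_eq`, ω^{n−1}v̄ = v and
∂^{(1)}_μ = v_μ∂_μ ([6I] (1.61)). [cite: BalabanImbrieJaffe1985, (7.1.18) p.323] -/
theorem conj_edgeW_mul_d1Sym (q : Tor M) (k : Fin d → Fin n) {μ ν : Fin d} (hμν : μ ≠ ν) :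
    conj (edgeW n k (sOf M q) μ ν) * d1Sym (sOf M q) μ = dSym n k (sOf M q) μ * conj (uTil n M q k ν) := by
  have hv := conj_om_pow_mul_vSym n M q k μ
  have hμ : μ ∈ Finset.univ.erase ν := Finset.mem_erase.mpr ⟨hμν, Finset.mem_univ μ⟩
  have hprod : ∏ ρ ∈ Finset.univ.erase ν, vSym n k (sOf M q) ρ
      = vSym n k (sOf M q) μ * ∏ ρ ∈ (Finset.univ.erase μ).erase ν, vSym n k (sOf M q) ρ := by
    rw [← Finset.mul_prod_erase _ _ hμ, Finset.erase_right_comm]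
  rw [edgeW_eq n M k q hμν, d1Sym_eq_vSym_mul n NeZero.one_le k (sOf M q) μ, uTil, hprod, map_mul, map_mul, map_mul,
    map_mul, ← hv]
  ring

/-- **The source of a unit curl is an η-curl at every offset**: `w̄(p′+l)⊙∂^{(1)}B = ∂(p′+l) ∧ β_l`, β_l = conj(ũ(p′+l))⊙B — (7.1.18)
fibrewise, every n, every offset, every p′ (diagonal entries vanish on both sides). [cite: BalabanImbrieJaffe1985, (7.1.18) p.323] -/
theorem srcK_curl1 (q : Tor M) (B : Fin d → ℂ) (k : Fin d → Fin n) (μ ν : Fin d) :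
    srcK n M q (curl1 M q B) k μ ν
      = dSym n k (sOf M q) μ * betaK n M q B k ν - dSym n k (sOf M q) ν * betaK n M q B k μ := by
  by_cases hμν : μ = ν
  · subst hμν
    simp [srcK, curl1]
  · have h1 := conj_edgeW_mul_d1Sym n M q k hμν
    have h2 := conj_edgeW_mul_d1Sym n M q k (Ne.symm hμν)
    rw [edgeW_symm n k (sOf M q) μ ν] at h2
    rw [srcK, curl1, betaK, betaK]
    dsimp only
    calc conj (edgeW n k (sOf M q) μ ν) * (d1Sym (sOf M q) μ * B ν - d1Sym (sOf M q) ν * B μ)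
        = conj (edgeW n k (sOf M q) μ ν) * d1Sym (sOf M q) μ * B ν
            - conj (edgeW n k (sOf M q) μ ν) * d1Sym (sOf M q) ν * B μ := by ring
      _ = dSym n k (sOf M q) μ * (conj (uTil n M q k ν) * B ν) - dSym n k (sOf M q) ν * (conj (uTil n M q k μ) * B μ) := by
          rw [h1, h2]
          ring

/-- The divergence of the source of a unit curl at the offset l: Σ_μ ∂̄_μ(∂∧β_l)_{μν} = Δ(p′+l)β_l(ν) − ∂_ν(p′+l)Σ_μ∂̄_μβ_l(μ).
[cite: BalabanImbrieJaffe1985, (7.1.31) p.325] -/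
theorem divK_curl1 (q : Tor M) (B : Fin d → ℂ) (k : Fin d → Fin n) (ν : Fin d) :
    divK n M q (curl1 M q B) k ν = (lapK n M q k : ℂ) * betaK n M q B k ν
      - dSym n k (sOf M q) ν * ∑ μ, conj (dSym n k (sOf M q) μ) * betaK n M q B k μ := by
  calc divK n M q (curl1 M q B) k ν
      = ∑ μ, (dSym n k (sOf M q) μ * conj (dSym n k (sOf M q) μ) * betaK n M q B k ν
          - dSym n k (sOf M q) ν * (conj (dSym n k (sOf M q) μ) * betaK n M q B k μ)) := by
        rw [divK]
        refine Finset.sum_congr rfl fun μ _ => ?_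
        rw [srcK_curl1]
        ring
    _ = _ := by rw [Finset.sum_sub_distrib, ← Finset.sum_mul, ← Finset.mul_sum, sum_dSym_mul_conj]

/-- **`u v_ν·conj(ũ_ν) = |u|²`** at every offset (ω^{n−1}v̄ = v again): the constraint weight pairs with the lifted one-form through
|u(p′+l)|² — the averaging weights of (7.1.16)/(2.24). [cite: BalabanImbrieJaffe1985, (7.1.16) p.323] -/
theorem rK_mul_conj_uTil (q : Tor M) (k : Fin d → Fin n) (ν : Fin d) :
    rK n M q k ν * conj (uTil n M q k ν) = ((‖uSym n k (sOf M q)‖ ^ 2 : ℝ) : ℂ) := by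
  have hv := conj_om_pow_mul_vSym n M q k ν
  calc rK n M q k ν * conj (uTil n M q k ν)
      = uSym n k (sOf M q) * (conj (om n k (sOf M q) ν ^ (n - 1)) * vSym n k (sOf M q) ν)
          * ∏ ρ ∈ Finset.univ.erase ν, conj (vSym n k (sOf M q) ρ) := by
        rw [rK, uTil, map_mul, map_prod]
        ring
    _ = uSym n k (sOf M q) * (conj (vSym n k (sOf M q) ν) * ∏ ρ ∈ Finset.univ.erase ν, conj (vSym n k (sOf M q) ρ)) := by
        rw [hv]
        ring
    _ = uSym n k (sOf M q) * ∏ ρ, conj (vSym n k (sOf M q) ρ) := by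
        rw [Finset.mul_prod_erase _ (fun ρ => conj (vSym n k (sOf M q) ρ)) (Finset.mem_univ ν)]
    _ = uSym n k (sOf M q) * conj (uSym n k (sOf M q)) := by rw [uSym, map_prod]
    _ = ((‖uSym n k (sOf M q)‖ ^ 2 : ℝ) : ℂ) := by
        rw [Complex.mul_conj']
        push_cast
        ring

/-! ## §2 Linearity of the source, its divergence and the multiplier one-form in φ -/

/-- The source is linear in φ. [cite: BalabanImbrieJaffe1985, (7.1.12) p.322] -/
theorem srcK_add (q : Tor M) (φ ψ : Fin d × Fin d → ℂ) (k : Fin d → Fin n) (μ ν : Fin d) :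
    srcK n M q (φ + ψ) k μ ν = srcK n M q φ k μ ν + srcK n M q ψ k μ ν := by
  simp only [srcK, Pi.add_apply, mul_add]

/-- The divergence of the source is linear in φ. [cite: BalabanImbrieJaffe1985, (7.1.13) p.322] -/
theorem divK_add (q : Tor M) (φ ψ : Fin d × Fin d → ℂ) (k : Fin d → Fin n) (ν : Fin d) :
    divK n M q (φ + ψ) k ν = divK n M q φ k ν + divK n M q ψ k ν := by
  simp only [divK, srcK_add, mul_add, Finset.sum_add_distrib]

/-- The multiplier one-form is linear in φ. [cite: BalabanImbrieJaffe1985, (7.1.16) p.323] -/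
theorem AK_add (q : Tor M) (φ ψ : Fin d × Fin d → ℂ) (ν : Fin d) :
    AK n M q (φ + ψ) ν = AK n M q φ ν + AK n M q ψ ν := by
  simp only [AK, divK_add, mul_add, add_div, Finset.sum_add_distrib]

/-! ## §3 The multiplier one-form on curls: A(∂^{(1)}B) = (Σ_l|u|²)B − ∂^{(1)}·C, and Σ_l|u(p′+l)|² = 1 -/


/-- **`A_ν(∂^{(1)}B) = (Σ_l |u(p′+l)|²)·B_ν − ∂^{(1)}_ν(p′)·C`** (no Δ(p′+l) = 0, i.e. p′ ≠ 0), with the explicit scalar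
C = Σ_l u(p′+l)(Σ_μ∂̄_μ(p′+l)β_l(μ))/Δ(p′+l): the τ₂ pairing on curls sees only B, up to a multiple of ∂^{(1)}(p′) which every
admissible multiplier annihilates — the dual form of (7.1.31). [cite: BalabanImbrieJaffe1985, (7.1.31) p.325] -/
theorem AK_curl1 (q : Tor M) (B : Fin d → ℂ) (hΔ : ∀ k, lapK n M q k ≠ 0) (ν : Fin d) :
    AK n M q (curl1 M q B) ν
      = (∑ k : Fin d → Fin n, ((‖uSym n k (sOf M q)‖ ^ 2 : ℝ) : ℂ)) * B ν
        - d1Sym (sOf M q) ν * ∑ k : Fin d → Fin n, uSym n k (sOf M q)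
            * (∑ μ, conj (dSym n k (sOf M q) μ) * betaK n M q B k μ) / (lapK n M q k : ℂ) := by
  rw [AK, Finset.sum_mul, Finset.mul_sum, ← Finset.sum_sub_distrib]
  refine Finset.sum_congr rfl fun k _ => ?_
  have hΔc : (lapK n M q k : ℂ) ≠ 0 := Complex.ofReal_ne_zero.mpr (hΔ k)
  set C : ℂ := ∑ μ, conj (dSym n k (sOf M q) μ) * betaK n M q B k μ with hC
  have h1 : rK n M q k ν * betaK n M q B k ν = ((‖uSym n k (sOf M q)‖ ^ 2 : ℝ) : ℂ) * B ν := by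
    rw [betaK, ← mul_assoc, rK_mul_conj_uTil]
  have h2 : rK n M q k ν * dSym n k (sOf M q) ν = uSym n k (sOf M q) * d1Sym (sOf M q) ν := by
    rw [mul_comm]
    exact dSym_mul_rK n M q k ν
  rw [divK_curl1, mul_sub, sub_div,
    show rK n M q k ν * ((lapK n M q k : ℂ) * betaK n M q B k ν) / (lapK n M q k : ℂ) = rK n M q k ν * betaK n M q B k ν by
      field_simp,
    h1, show rK n M q k ν * (dSym n k (sOf M q) ν * C) / (lapK n M q k : ℂ)
      = rK n M q k ν * dSym n k (sOf M q) ν * C / (lapK n M q k : ℂ) by ring, h2]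
  ring

section OnTorus

variable [hM : ∀ μ, NeZero (M μ)]

/-- **Σ_l |u(p′+l)|² = 1** over the complete residue system of offsets, every n ≥ 1 and every unit momentum of the torus: the
momentum form of Q^e_kQ^{e*}_k ∝ I (2.24) / the [6I] averaging identity, pub-balaban's `B5Prop11Leaves.sum_Ur_eq_one`.
[cite: BalabanImbrieJaffe1985, (2.24) p.305] -/
theorem sum_norm_uSym_sq (q : Tor M) : ∑ k : Fin d → Fin n, ‖uSym n k (sOf M q)‖ ^ 2 = 1 := by
  have hs : ∀ μ, |sOf M q μ| ≤ Real.pi := fun μ => abs_sOf_le M q μ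
  simp_rw [norm_uSym_sq n NeZero.one_le _ (sOf M q) hs]
  exact sum_Ur_eq_one n NeZero.one_le (sOf M q) hs

/-- **THE τ₂ PAIRING ON CURLS**: for every multiplier Λ annihilated by ∂^{(1)}(p′) (Σ_ν ∂^{(1)}_ν(p′)Λ_ν = 0) and every unit one-form
B, `Σ_ν Λ_νA_ν(∂^{(1)}B) = Σ_ν Λ_νB_ν` (p′ ≠ 0) — in the dual formulation this is *"⟨∂B, τ₂∂B⟩ = ⟨B, Δ_kB⟩ (7.1.31)"*: the
constraint sees a curl exactly through its unit potential. [cite: BalabanImbrieJaffe1985, (7.1.31) p.325] -/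
theorem pairing_curl1 (q : Tor M) (B : Fin d → ℂ) (hΔ : ∀ k, lapK n M q k ≠ 0) (Λ : Fin d → ℂ)
    (hΛ : ∑ ν, d1Sym (sOf M q) ν * Λ ν = 0) :
    ∑ ν, Λ ν * AK n M q (curl1 M q B) ν = ∑ ν, Λ ν * B ν := by
  have hS : (∑ k : Fin d → Fin n, ((‖uSym n k (sOf M q)‖ ^ 2 : ℝ) : ℂ)) = 1 := by
    rw [← Complex.ofReal_sum, sum_norm_uSym_sq, Complex.ofReal_one]
  set C : ℂ := ∑ k : Fin d → Fin n, uSym n k (sOf M q)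
      * (∑ μ, conj (dSym n k (sOf M q) μ) * betaK n M q B k μ) / (lapK n M q k : ℂ) with hC
  have hterm : ∀ ν, Λ ν * AK n M q (curl1 M q B) ν = Λ ν * B ν - C * (d1Sym (sOf M q) ν * Λ ν) := by
    intro ν
    rw [AK_curl1 n M q B hΔ ν, hS, one_mul, ← hC]
    ring
  simp_rw [hterm]
  rw [Finset.sum_sub_distrib, ← Finset.mul_sum, hΛ, mul_zero, sub_zero]

end OnTorus

end

end Literature.MathematicalPhysics.QuantumFieldTheory.BalabanImbrieJaffe1984to88.BIJ85FibreCurlIntertwine
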